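import Mathlib
import Literature.MathematicalPhysics.QuantumFieldTheory.MirrorRPKernel
import Literature.MeasureTheory.Integral.PowerWeightedLineIntegral
import HarnessLib

/-!
# X-ray reduction
# (S6 of line `entire-profile-null-growth`, crux `PrecisionLaplacian.StableConeRPRigidity`)

Registered stub `stub_xRayReduction` of the lead's skeleton, restated verbatim and proved.

**Statement.** `S5 →` (planar four-line rigidity) `→` for a kernel `K` on `ℝ³`, continuous and
positive off `0`, homogeneous of degree `-β`, invariant and reflection positive (`IsMirrorRPKernel`)
in the nine lattice mirrors `eᵢ`, `eᵢ ± eⱼ`, and exponents `0 < δ < 1`, `1 < β + δ < 5`, the probed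
axial X-ray `y ↦ ∫ K (y + s eᵢ) |s|^{-δ} ds` depends only on `‖y‖` on `eᵢ^⊥ ∖ 0`.

**Proof.** Let `ι : ℝ² → ℝ³` be the coordinate isometric embedding onto `eᵢ^⊥`
(`xRay_exists_axialEmbedding`, via `Fin.insertNth i 0`) and `k z := ∫ K (ι z + s eᵢ) |s|^{-δ} ds`.
By `Literature.MeasureTheory.Integral.PowerWeightedLineIntegral` (`K ≤ M ‖x‖^{-β}` from
homogeneity and continuity on the unit sphere; dominated convergence; the substitution `s = c s'`)
`k` is continuous and positive on `ℝ² ∖ 0` and homogeneous of degree `-(β + δ - 1) ∈ (-4, 0)`.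
The four planar lines `e₀, e₁, e₀ ± e₁` lift under `ι` to the lattice mirrors `e_j, e_k, e_j ± e_k`
(`j, k = i.succAbove 0, 1`), which are orthogonal to `eᵢ`; their reflections commute with `ι` and
fix `eᵢ` (`xRay_reflection_line`), so `k` inherits invariance from `K`, and reflection positivity
from the antecedent S5 applied to the lifted mirror and the points `ι q_a`.  Planar rigidity makes
`k` invariant under all planar isometries, which act transitively on circles
(`Submodule.reflection_sub`); finally every `y ⊥ eᵢ` is `ι z` with `‖z‖ = ‖y‖`.
-/

open MeasureTheory
open scoped BigOperators InnerProductSpace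

namespace Summit.CriticalPhenomena.Ising3DConformalLimit.Cruxes.StableConeRPRigidity.EntireProfileNullGrowth

noncomputable section

open Literature.MathematicalPhysics.QuantumFieldTheory Literature.MeasureTheory.Integral

/-! ## The coordinate embedding `ℝ² ≅ eᵢ^⊥ ⊂ ℝ³` -/

/-- The coordinate isometric embedding `ι : ℝ² → ℝ³` onto `eᵢ^⊥`: `(ι z) i = 0` and
`(ι z) (i.succAbove t) = z t` (insert a zero `i`-th coordinate). -/
theorem xRay_exists_axialEmbedding (i : Fin 3) :
    ∃ ι : EuclideanSpace ℝ (Fin 2) →ₗᵢ[ℝ] EuclideanSpace ℝ (Fin 3),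
      (∀ z, ι z i = 0) ∧ (∀ z (t : Fin 2), ι z (i.succAbove t) = z t) := by
  let f : EuclideanSpace ℝ (Fin 2) →ₗ[ℝ] EuclideanSpace ℝ (Fin 3) :=
    { toFun := fun z => WithLp.toLp 2 (Fin.insertNth (α := fun _ => ℝ) i (0:ℝ) (WithLp.ofLp z))
      map_add' := by
        intro z w
        ext m
        rcases Fin.eq_self_or_eq_succAbove i m with rfl | ⟨t, rfl⟩
        · simp [Fin.insertNth_apply_same]
        · simp [Fin.insertNth_apply_succAbove]
      map_smul' := by
        intro c z
        ext m
        rcases Fin.eq_self_or_eq_succAbove i m with rfl | ⟨t, rfl⟩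
        · simp [Fin.insertNth_apply_same]
        · simp [Fin.insertNth_apply_succAbove] }
  have hf0 : ∀ z, f z i = 0 := fun z => by simp [f, Fin.insertNth_apply_same]
  have hf1 : ∀ z (t : Fin 2), f z (i.succAbove t) = z t := fun z t => by
    simp [f, Fin.insertNth_apply_succAbove]
  have hf : ∀ z, ‖f z‖ = ‖z‖ := by
    intro z
    rw [EuclideanSpace.norm_eq, EuclideanSpace.norm_eq, Fin.sum_univ_succAbove _ i]
    simp [hf0, hf1]
  exact ⟨⟨f, hf⟩, hf0, hf1⟩

/-- The embedding maps the planar basis vector `e_t` to the spatial basis vector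
`e_{i.succAbove t}`. -/
theorem xRay_embed_single {i : Fin 3} {ι : EuclideanSpace ℝ (Fin 2) →ₗᵢ[ℝ] EuclideanSpace ℝ (Fin 3)}
    (h0 : ∀ z, ι z i = 0) (h1 : ∀ z (t : Fin 2), ι z (i.succAbove t) = z t) (t₀ : Fin 2) :
    ι (EuclideanSpace.single t₀ (1:ℝ)) = EuclideanSpace.single (i.succAbove t₀) (1:ℝ) := by
  ext m
  rcases Fin.eq_self_or_eq_succAbove i m with rfl | ⟨t, rfl⟩
  · rw [h0]; simp [Fin.ne_succAbove]
  · rw [h1]; simp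

/-- The image of the embedding is orthogonal to `eᵢ`. -/
theorem xRay_embed_inner {i : Fin 3} {ι : EuclideanSpace ℝ (Fin 2) →ₗᵢ[ℝ] EuclideanSpace ℝ (Fin 3)}
    (h0 : ∀ z, ι z i = 0) (z : EuclideanSpace ℝ (Fin 2)) :
    ⟪ι z, EuclideanSpace.single i (1:ℝ)⟫_ℝ = 0 := by
  rw [EuclideanSpace.inner_single_right]; simp [h0]

/-- The embedding is onto `eᵢ^⊥`. -/
theorem xRay_embed_surj {i : Fin 3} {ι : EuclideanSpace ℝ (Fin 2) →ₗᵢ[ℝ] EuclideanSpace ℝ (Fin 3)}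
    (h0 : ∀ z, ι z i = 0) (h1 : ∀ z (t : Fin 2), ι z (i.succAbove t) = z t)
    {y : EuclideanSpace ℝ (Fin 3)} (hy : ⟪y, EuclideanSpace.single i (1:ℝ)⟫_ℝ = 0) :
    ∃ z, ι z = y := by
  refine ⟨WithLp.toLp 2 (fun t => y (i.succAbove t)), ?_⟩
  have hyi : y i = 0 := by simpa [EuclideanSpace.inner_single_right] using hy
  ext m
  rcases Fin.eq_self_or_eq_succAbove i m with rfl | ⟨t, rfl⟩
  · rw [h0, hyi]
  · rw [h1]

/-- The embedded vectors are nonzero when the planar ones are. -/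
theorem xRay_embed_ne_zero (ι : EuclideanSpace ℝ (Fin 2) →ₗᵢ[ℝ] EuclideanSpace ℝ (Fin 3))
    {z : EuclideanSpace ℝ (Fin 2)} (hz : z ≠ 0) : ι z ≠ 0 := fun h =>
  hz (norm_eq_zero.1 (by rw [← ι.norm_map, h, norm_zero]))

/-! ## Transport of mirror reflections along the embedding -/

/-- Mirror reflections commute with linear isometric embeddings: `ι (θ_ℓ x) = θ_{ι ℓ} (ι x)`. -/
theorem xRay_map_reflection (ι : EuclideanSpace ℝ (Fin 2) →ₗᵢ[ℝ] EuclideanSpace ℝ (Fin 3))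
    (ℓ x : EuclideanSpace ℝ (Fin 2)) :
    ι ((ℝ ∙ ℓ)ᗮ.reflection x) = (ℝ ∙ ι ℓ)ᗮ.reflection (ι x) := by
  rw [mirrorReflection_apply, mirrorReflection_apply, LinearIsometry.inner_map_map,
    LinearIsometry.norm_map, map_sub, LinearIsometry.map_smul]

/-- The lifted mirror acts on the probing line `ι x + s e` (`e ⊥ ι ℓ`) through the planar mirror:
`θ_{ι ℓ} (ι x + s e) = ι (θ_ℓ x) + s e`. -/
theorem xRay_reflection_line (ι : EuclideanSpace ℝ (Fin 2) →ₗᵢ[ℝ] EuclideanSpace ℝ (Fin 3))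
    {e : EuclideanSpace ℝ (Fin 3)} {ℓ : EuclideanSpace ℝ (Fin 2)} (h : ⟪e, ι ℓ⟫_ℝ = 0)
    (x : EuclideanSpace ℝ (Fin 2)) (s : ℝ) :
    (ℝ ∙ ι ℓ)ᗮ.reflection (ι x + s • e) = ι ((ℝ ∙ ℓ)ᗮ.reflection x) + s • e := by
  rw [map_add, LinearIsometryEquiv.map_smul, xRay_map_reflection,
    mirrorReflection_of_inner_eq_zero h]

/-! ## The registered stub -/

/-- Registered stub `stub_xRayReduction` — **S6 · X-ray reduction**: the antecedent S5 (reflection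
positivity of the axially probed X-ray) and planar four-line rigidity imply that the probed axial
X-rays `y ↦ ∫ K (y + s eᵢ) |s|^{-δ} ds` of a continuous positive kernel on `ℝ³ ∖ 0`, homogeneous
of degree `-β`, invariant and RP in the nine lattice mirrors, with `0 < δ < 1 < β + δ < 5`, are
radial on `eᵢ^⊥ ∖ 0` for every axis `eᵢ`.  (Statement verbatim = `XRayReduction` of the lead's
skeleton.) -/
theorem stub_xRayReduction :
    (∀ (β δ : ℝ) (K : EuclideanSpace ℝ (Fin 3) → ℝ) (i : Fin 3) (n : EuclideanSpace ℝ (Fin 3)),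
      0 < δ → δ < 1 → 1 < β + δ →
      ContinuousOn K {0}ᶜ → (∀ x, x ≠ 0 → 0 < K x) →
      (∀ c : ℝ, 0 < c → ∀ x, K (c • x) = c ^ (-β) * K x) →
      Literature.MathematicalPhysics.QuantumFieldTheory.IsMirrorRPKernel n K →
      inner ℝ n (EuclideanSpace.single i (1:ℝ)) = 0 →
      ∀ (m : ℕ) (p : Fin m → EuclideanSpace ℝ (Fin 3)) (c : Fin m → ℝ), (∀ a, 0 < inner ℝ (p a) n) →
        0 ≤ ∑ a, ∑ b, c a * c b *
          ∫ s : ℝ, K (p a - ((ℝ ∙ n)ᗮ).reflection (p b) + s • EuclideanSpace.single i (1:ℝ)) * |s| ^ (-δ)) →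
    (∀ (β : ℝ) (k : EuclideanSpace ℝ (Fin 2) → ℝ), 0 < β → β < 4 →
      ContinuousOn k {0}ᶜ → (∀ y, y ≠ 0 → 0 < k y) →
      (∀ c : ℝ, 0 < c → ∀ y, k (c • y) = c ^ (-β) * k y) →
      (∀ ℓ : EuclideanSpace ℝ (Fin 2), (ℓ = EuclideanSpace.single 0 1 ∨ ℓ = EuclideanSpace.single 1 1 ∨
        ℓ = EuclideanSpace.single 0 1 + EuclideanSpace.single 1 1 ∨ ℓ = EuclideanSpace.single 0 1 - EuclideanSpace.single 1 1) →
        (∀ y, k (((ℝ ∙ ℓ)ᗮ).reflection y) = k y) ∧ Literature.MathematicalPhysics.QuantumFieldTheory.IsMirrorRPKernel ℓ k) →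
      ∀ (R : EuclideanSpace ℝ (Fin 2) ≃ₗᵢ[ℝ] EuclideanSpace ℝ (Fin 2)) (y : EuclideanSpace ℝ (Fin 2)), k (R y) = k y) →
    ∀ (β δ : ℝ) (K : EuclideanSpace ℝ (Fin 3) → ℝ), 0 < δ → δ < 1 → 1 < β + δ → β + δ < 5 →
      ContinuousOn K {0}ᶜ → (∀ x, x ≠ 0 → 0 < K x) →
      (∀ c : ℝ, 0 < c → ∀ x, K (c • x) = c ^ (-β) * K x) →
      (∀ n : EuclideanSpace ℝ (Fin 3), (∃ i j : Fin 3, i ≠ j ∧ (n = EuclideanSpace.single i 1 ∨ n = EuclideanSpace.single i 1 + EuclideanSpace.single j 1 ∨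
        n = EuclideanSpace.single i 1 - EuclideanSpace.single j 1)) →
        (∀ x, K (((ℝ ∙ n)ᗮ).reflection x) = K x) ∧ Literature.MathematicalPhysics.QuantumFieldTheory.IsMirrorRPKernel n K) →
      ∀ (i : Fin 3) (y y' : EuclideanSpace ℝ (Fin 3)), inner ℝ y (EuclideanSpace.single i (1:ℝ)) = 0 →
        inner ℝ y' (EuclideanSpace.single i (1:ℝ)) = 0 → y ≠ 0 → ‖y‖ = ‖y'‖ →
        ∫ s : ℝ, K (y + s • EuclideanSpace.single i (1:ℝ)) * |s| ^ (-δ) =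
          ∫ s : ℝ, K (y' + s • EuclideanSpace.single i (1:ℝ)) * |s| ^ (-δ) := by
  intro hS5 hS4 β δ K hδ0 hδ1 hβδ hβδ5 hKc hKp hhom hmir i y y' hy hy' _hy0 hyy'
  -- the coordinate embedding and the planar preimages of `y`, `y'`
  obtain ⟨ι, h0, h1⟩ := xRay_exists_axialEmbedding i
  obtain ⟨z, rfl⟩ := xRay_embed_surj h0 h1 hy
  obtain ⟨z', rfl⟩ := xRay_embed_surj h0 h1 hy'
  have hzz' : ‖z‖ = ‖z'‖ := by rwa [ι.norm_map, ι.norm_map] at hyy'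
  set e : EuclideanSpace ℝ (Fin 3) := EuclideanSpace.single i (1:ℝ) with he_def
  have he : ‖e‖ = 1 := by rw [he_def]; simp
  have hιe : ∀ w, ⟪ι w, e⟫_ℝ = 0 := fun w => xRay_embed_inner h0 w
  obtain ⟨M, hM, hKM⟩ := exists_bound_of_continuousOn_of_homogeneous hKc hhom
  -- the planar kernel `k z = ∫ K (ι z + s e) |s|^{-δ} ds`
  obtain ⟨k, hk⟩ : ∃ k : EuclideanSpace ℝ (Fin 2) → ℝ,
      ∀ w, k w = ∫ s : ℝ, K (ι w + s • e) * |s| ^ (-δ) := ⟨_, fun w => rfl⟩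
  -- (1) continuity off the origin
  have hk_cont : ContinuousOn k {0}ᶜ := by
    have hc := continuousOn_powerWeightedXRay (δ := δ) he hδ1 hβδ hKc hM hKM
    have : k = (fun v => ∫ t : ℝ, K (v + t • e) * |t| ^ (-δ)) ∘ ι := funext fun w => hk w
    rw [this]
    exact hc.comp ι.continuous.continuousOn fun w hw => ⟨hιe w, xRay_embed_ne_zero ι hw⟩
  -- (2) positivity off the origin
  have hk_pos : ∀ w, w ≠ 0 → 0 < k w := fun w hw => by
    rw [hk]
    exact powerWeightedXRay_pos he hδ1 hβδ hKc hKp hM hKM (hιe w) (xRay_embed_ne_zero ι hw)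
  -- (3) homogeneity of degree `-(β + δ - 1)`
  have hk_hom : ∀ c : ℝ, 0 < c → ∀ w, k (c • w) = c ^ (-(β + δ - 1)) * k w := by
    intro c hc w
    rw [hk, hk, LinearIsometry.map_smul]
    exact powerWeightedXRay_smul δ e hhom hc (ι w)
  -- (4) invariance and RP in the four planar lines
  have hjk : i.succAbove 0 ≠ i.succAbove 1 := fun h =>
    absurd (Fin.succAbove_right_injective h) (by decide)
  have hk_lines : ∀ ℓ : EuclideanSpace ℝ (Fin 2), (ℓ = EuclideanSpace.single 0 1 ∨
      ℓ = EuclideanSpace.single 1 1 ∨ ℓ = EuclideanSpace.single 0 1 + EuclideanSpace.single 1 1 ∨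
      ℓ = EuclideanSpace.single 0 1 - EuclideanSpace.single 1 1) →
      (∀ y, k (((ℝ ∙ ℓ)ᗮ).reflection y) = k y) ∧ IsMirrorRPKernel ℓ k := by
    intro ℓ hℓ
    have hn : ∃ i' j' : Fin 3, i' ≠ j' ∧ (ι ℓ = EuclideanSpace.single i' 1 ∨
        ι ℓ = EuclideanSpace.single i' 1 + EuclideanSpace.single j' 1 ∨
        ι ℓ = EuclideanSpace.single i' 1 - EuclideanSpace.single j' 1) := by
      have hs0 := xRay_embed_single h0 h1 0
      have hs1 := xRay_embed_single h0 h1 1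
      rcases hℓ with rfl | rfl | rfl | rfl
      · exact ⟨_, _, hjk, Or.inl hs0⟩
      · exact ⟨_, _, hjk.symm, Or.inl hs1⟩
      · exact ⟨_, _, hjk, Or.inr (Or.inl (by rw [map_add, hs0, hs1]))⟩
      · exact ⟨_, _, hjk, Or.inr (Or.inr (by rw [map_sub, hs0, hs1]))⟩
    obtain ⟨hinv, hrp⟩ := hmir (ι ℓ) hn
    have hperp : ⟪e, ι ℓ⟫_ℝ = 0 := by rw [real_inner_comm]; exact hιe ℓ
    refine ⟨fun x => ?_, fun m q c hq => ?_⟩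
    · rw [hk, hk]
      congr 1
      funext s
      rw [← xRay_reflection_line ι hperp x s, hinv]
    · have h5 := hS5 β δ K i (ι ℓ) hδ0 hδ1 hβδ hKc hKp hhom hrp (xRay_embed_inner h0 ℓ) m
        (fun a => ι (q a)) c (fun a => by rw [LinearIsometry.inner_map_map]; exact hq a)
      simp only [hk]
      simp_rw [map_sub, xRay_map_reflection]
      exact h5
  -- (5) planar rigidity: `k` is invariant under all planar isometries, hence radial
  have hrad := hS4 (β + δ - 1) k (by linarith) (by linarith) hk_cont hk_pos hk_hom hk_lines
  have key := hrad ((ℝ ∙ (z - z'))ᗮ.reflection) z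
  rw [Submodule.reflection_sub hzz'] at key
  rw [← hk, ← hk]
  exact key.symm

end

end Summit.CriticalPhenomena.Ising3DConformalLimit.Cruxes.StableConeRPRigidity.EntireProfileNullGrowth
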